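import Mathlib
import Summits.MatrixMultiplication.MatrixMultiplication.Theorems.SoloBlindTypeModel
import Summits.MatrixMultiplication.MatrixMultiplication.Theorems.SoloBlindZModBasis

/-!
# (K₃) and Conjecture E at corank at most three, in every rank (solo-blind programme, K3.35)

`B ⊆ S` subset-sum-distinct with `|S \\ B| ≤ 3`, `h` zero-sum free on `S` (exponent `3`):
* `soloBlind_kraft_corank_le_three`: `K(τ; S) = ∑_{T ⊆ S, ∑_T h = τ} 2^{-|T|} ≤ 1` for every `τ`;
* `soloBlind_conjE_corank_le_three`: if moreover `τ` is H-good on `S` then `K(τ; S) ≤ 1/2`.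

Proof = the presence reduction (`soloBlind_kraft_reduction`, `soloBlind_conjE_reduction`: it suffices
to treat targets whose presence family over the `≤ 3` outside points is two-sided proper) + the type
model (`soloBlind_typeModel_kraft` / `_conjE`: the mass is bounded once the per-family type oracle
accepts the exact presence family) + the kernel-evaluated certificates `soloBlind_certAll_zero … three`
(every proper two-sided family of bitmasks over `m ≤ 3` points is accepted in both modes).  The block is
made linearly independent over `ZMod 3` by `AddCommGroup.zmodModule` and
`soloBlind_linearIndependent_of_subsetSum_inj`.
-/

namespace Summit.MatrixMultiplication.MatrixMultiplication.Theorems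

open Finset Module

variable {G : Type*} [AddCommGroup G] [DecidableEq G] {ι : Type*} [DecidableEq ι]

omit [AddCommGroup G] [DecidableEq G] [DecidableEq ι] in
/-- Enumerating a finset by `Fin`. -/
theorem soloBlind_exists_enum (X : Finset ι) : ∃ x : Fin X.card ↪ ι, Finset.univ.map x = X := by
  refine ⟨X.equivFin.symm.toEmbedding.trans (Function.Embedding.subtype _), ?_⟩
  ext y
  constructor
  · intro hy
    rw [Finset.mem_map] at hy
    obtain ⟨a, -, rfl⟩ := hy
    exact (X.equivFin.symm a).2
  · intro hy
    rw [Finset.mem_map]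
    exact ⟨X.equivFin ⟨y, hy⟩, Finset.mem_univ _, by simp⟩

omit [DecidableEq ι] in
/-- CERTIFIED ACCEPTANCE (`m ≤ 3`): the exact presence family of a target whose presence family is
two-sided proper is accepted by the oracle in both modes, by the kernel-evaluated certificates. -/
theorem soloBlind_exactFam_checks {h : ι → G} {B : Finset ι} {m : ℕ} (hm : m ≤ 3)
    (x : Fin m ↪ ι) {τ : G} (hts : soloBlindTwoSidedProper h B (Finset.univ.map x) τ) :
    soloBlindFamCheck (soloBlindMkTabs m) m soloBlindScale (soloBlindExactFam h B x τ) false = true ∧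
      soloBlindFamCheck (soloBlindMkTabs m) m soloBlindScale (soloBlindExactFam h B x τ) true = true := by
  have hcert : soloBlindCertAll m = true := by
    interval_cases m
    · exact soloBlind_certAll_zero
    · exact soloBlind_certAll_one
    · exact soloBlind_certAll_two
    · exact soloBlind_certAll_three
  refine soloBlind_certAll_extract hcert (soloBlind_exactFam_sublist h B x τ) ?_ ?_
  · obtain ⟨C, hC, hnp⟩ := hts.1
    obtain ⟨M, hM, rfl⟩ := soloBlind_exists_mask x hC
    exact ⟨M, hM, fun hmem => hnp
      ((soloBlind_present_map_iff h B x τ M).mpr (soloBlind_mem_exactFam.mp hmem).2)⟩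
  · intro a ha
    obtain ⟨⟨C₁, hC₁, hx₁, hp₁⟩, ⟨C₂, hC₂, hx₂, hp₂⟩⟩ :=
      hts.2 (x ⟨a, ha⟩) (Finset.mem_map_of_mem x (Finset.mem_univ _))
    obtain ⟨M₁, hM₁, rfl⟩ := soloBlind_exists_mask x hC₁
    obtain ⟨M₂, hM₂, rfl⟩ := soloBlind_exists_mask x hC₂
    rw [Finset.mem_map' x] at hx₁ hx₂
    refine ⟨⟨M₁, soloBlind_mem_exactFam.mpr ⟨hM₁, (soloBlind_present_map_iff h B x τ M₁).mp hp₁⟩,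
        (soloBlind_mem_decSet ⟨a, ha⟩).mp hx₁⟩,
      ⟨M₂, soloBlind_mem_exactFam.mpr ⟨hM₂, (soloBlind_present_map_iff h B x τ M₂).mp hp₂⟩,
        Bool.eq_false_iff.mpr fun ht => hx₂ ((soloBlind_mem_decSet ⟨a, ha⟩).mpr ht)⟩⟩

omit [DecidableEq G] [DecidableEq ι] in
/-- The exponent-three hypothesis in `nsmul` form. -/
theorem soloBlind_three_nsmul_of_add (three : ∀ g : G, g + g + g = 0) (g : G) : 3 • g = 0 := by
  rw [show (3 : ℕ) = 2 + 1 from rfl, succ_nsmul, two_nsmul]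
  exact three g

/-- HANDLER, mode K: a two-sided proper target over at most three outside points has mass `≤ 1`. -/
theorem soloBlind_handler_kraft (three : ∀ g : G, g + g + g = 0) {h : ι → G} {B X : Finset ι}
    (hdist : ∀ A ⊆ B, ∀ A' ⊆ B, ∑ i ∈ A, h i = ∑ i ∈ A', h i → A = A')
    (hXB : Disjoint B X) (hX : X.card ≤ 3)
    (zsf : ∀ T ⊆ B ∪ X, T.Nonempty → ∑ i ∈ T, h i ≠ 0) {τ : G}
    (hts : soloBlindTwoSidedProper h B X τ) : soloBlindMass h (B ∪ X) τ ≤ 1 := by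
  obtain ⟨x, hx⟩ := soloBlind_exists_enum X
  have hxB : ∀ a, x a ∉ B := fun a ha => by
    have hxa : x a ∈ Finset.univ.map x := Finset.mem_map_of_mem x (Finset.mem_univ a)
    rw [hx] at hxa
    exact Finset.disjoint_left.mp hXB ha hxa
  rw [← hx] at zsf hts ⊢
  letI : Module (ZMod 3) G := AddCommGroup.zmodModule (soloBlind_three_nsmul_of_add three)
  have hli : LinearIndependent (ZMod 3) (fun i : B => h i) :=
    soloBlind_linearIndependent_of_subsetSum_inj h B hdist
  obtain ⟨hK, -⟩ := soloBlind_exactFam_checks hX x hts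
  exact soloBlind_typeModel_kraft hli hdist x hxB τ soloBlindScale zsf hK

/-- HANDLER, mode E: an H-good two-sided proper target over at most three outside points has mass
`≤ 1/2`. -/
theorem soloBlind_handler_conjE (three : ∀ g : G, g + g + g = 0) {h : ι → G} {B X : Finset ι}
    (hdist : ∀ A ⊆ B, ∀ A' ⊆ B, ∑ i ∈ A, h i = ∑ i ∈ A', h i → A = A')
    (hXB : Disjoint B X) (hX : X.card ≤ 3)
    (zsf : ∀ T ⊆ B ∪ X, T.Nonempty → ∑ i ∈ T, h i ≠ 0) {τ : G}
    (hgood : ∀ T ⊆ B ∪ X, ∑ i ∈ T, h i ≠ τ + τ)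
    (hts : soloBlindTwoSidedProper h B X τ) : soloBlindMass h (B ∪ X) τ ≤ 1 / 2 := by
  obtain ⟨x, hx⟩ := soloBlind_exists_enum X
  have hxB : ∀ a, x a ∉ B := fun a ha => by
    have hxa : x a ∈ Finset.univ.map x := Finset.mem_map_of_mem x (Finset.mem_univ a)
    rw [hx] at hxa
    exact Finset.disjoint_left.mp hXB ha hxa
  rw [← hx] at zsf hgood hts ⊢
  letI : Module (ZMod 3) G := AddCommGroup.zmodModule (soloBlind_three_nsmul_of_add three)
  have hli : LinearIndependent (ZMod 3) (fun i : B => h i) :=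
    soloBlind_linearIndependent_of_subsetSum_inj h B hdist
  obtain ⟨-, hE⟩ := soloBlind_exactFam_checks hX x hts
  exact soloBlind_typeModel_conjE hli hdist x hxB τ (by decide) zsf hgood hE

/-- (K₃) AT CORANK AT MOST THREE (every rank, exponent `3`): `B ⊆ S` subset-sum-distinct with
`|S \\ B| ≤ 3` and `h` zero-sum free on `S` ⟹ `K(τ; S) ≤ 1` for every `τ`. -/
theorem soloBlind_kraft_corank_le_three (three : ∀ g : G, g + g + g = 0) {h : ι → G} {S B : Finset ι}
    (hBS : B ⊆ S) (hc : (S \ B).card ≤ 3)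
    (hdist : ∀ A ⊆ B, ∀ A' ⊆ B, ∑ i ∈ A, h i = ∑ i ∈ A', h i → A = A')
    (zsf : ∀ T ⊆ S, T.Nonempty → ∑ i ∈ T, h i ≠ 0) (τ : G) : soloBlindMass h S τ ≤ 1 := by
  have hS : B ∪ S \ B = S := Finset.union_sdiff_of_subset hBS
  rw [← hS] at zsf ⊢
  exact soloBlind_kraft_reduction three hdist (S \ B) Finset.disjoint_sdiff zsf
    (fun X' hX' τ' hts => soloBlind_handler_kraft three hdist
      (Finset.disjoint_of_subset_right hX' Finset.disjoint_sdiff)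
      (le_trans (Finset.card_le_card hX') hc)
      (fun T hT hne => zsf T (hT.trans (Finset.union_subset_union (le_refl B) hX')) hne) hts) τ

/-- CONJECTURE E AT CORANK AT MOST THREE (every rank, exponent `3`): `B ⊆ S` subset-sum-distinct with
`|S \\ B| ≤ 3`, `h` zero-sum free on `S`, `τ` H-good on `S` ⟹ `E(τ; S) ≤ 1/2`. -/
theorem soloBlind_conjE_corank_le_three (three : ∀ g : G, g + g + g = 0) {h : ι → G} {S B : Finset ι}
    (hBS : B ⊆ S) (hc : (S \ B).card ≤ 3)
    (hdist : ∀ A ⊆ B, ∀ A' ⊆ B, ∑ i ∈ A, h i = ∑ i ∈ A', h i → A = A')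
    (zsf : ∀ T ⊆ S, T.Nonempty → ∑ i ∈ T, h i ≠ 0) {τ : G} (hgood : ∀ T ⊆ S, ∑ i ∈ T, h i ≠ τ + τ) :
    soloBlindMass h S τ ≤ 1 / 2 := by
  have hS : B ∪ S \ B = S := Finset.union_sdiff_of_subset hBS
  rw [← hS] at zsf hgood ⊢
  exact soloBlind_conjE_reduction three hdist (S \ B) Finset.disjoint_sdiff zsf hgood
    (fun X' hX' τ' hts => soloBlind_handler_kraft three hdist
      (Finset.disjoint_of_subset_right hX' Finset.disjoint_sdiff)
      (le_trans (Finset.card_le_card hX') hc)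
      (fun T hT hne => zsf T (hT.trans (Finset.union_subset_union (le_refl B) hX')) hne) hts)
    (fun X' hX' hts => soloBlind_handler_conjE three hdist
      (Finset.disjoint_of_subset_right hX' Finset.disjoint_sdiff)
      (le_trans (Finset.card_le_card hX') hc)
      (fun T hT hne => zsf T (hT.trans (Finset.union_subset_union (le_refl B) hX')) hne)
      (fun T hT => hgood T (hT.trans (Finset.union_subset_union (le_refl B) hX'))) hts)

end Summit.MatrixMultiplication.MatrixMultiplication.Theorems
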